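import Summits.ResolutionOfSingularities.ResolutionOfSingularities.Theorems.FrobeniusClosingPatchingRelPerfectTwoPlanesCharts
import Summits.ResolutionOfSingularities.ResolutionOfSingularities.Theorems.FrobeniusClosingPatchingRelPerfectTwoPlanesLevelTwo
import Summits.ResolutionOfSingularities.ResolutionOfSingularities.Theorems.FrobeniusClosingPatchingRelPerfectConeCubeSide
import Summits.ResolutionOfSingularities.ResolutionOfSingularities.Theorems.FrobeniusClosingPatchingRelPerfectConeCubeLevelTwo
import HarnessLib

/-!
# Crux `PatchingRelPerfect` (stmt-ResolutionOfSingularities-16161), chain w52 — the rank-two member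
# `f = x₀x₁ + x₂³`: the `x₀`-chart `B₀` of `Bl_𝔪` (two-letter tower `(H♯; u)`, word `(u, 1, u)`)

[OURS · L1 W5.2 · rung, DESIGN STAGE → third regularity brick] On the chart `B₀` (`u = x₀`,
`e₀ = 1`) the strict transform `H♯ = e₀e₁ + u e₂³ = e₁ + u e₂³` of `f` is a REGULAR hypersurface
transversal to the exceptional divisor, and the companion factors of the design note
NEXT-two-planes-cube.md map to (`…TwoPlanesCharts` at `i = 0`):
`A = (f) + x₀𝔪 + 𝔪³ ↦ (u)²`, `A₃ = (f) + 𝔪³ ↦ (u)²(H♯, u)`, `A₄ = (f) + x₀𝔪² + 𝔪⁴ ↦ (u)²(H♯, u)`,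
`I = (f) + 𝔪⁴ ↦ (u)²(H♯, u²)` — a two-letter flag `∏_{s<3} (H♯, L₀⋯L_s)` with the word `(u, 1, u)`.
PROVED: the hypotheses of `isRegular_of_isBlowup_letterTower_two''` on `B₀` (`(H♯, u)` quasi-regular,
`B₀/(H♯, u) = B₀/(u, e₁)` regular, `u ≠ 0`), the flag form of the images, and

* `isRegular_of_isBlowup_zFlag` — every blowing up of `Spec B₀` along `(u)ᵃ · ∏_{s<N} (H♯, L₀⋯L_s)`
  with letters in `{u, 1}` is regular;
* `isRegular_of_isBlowup_tpProd_zero` — in particular along the image of `A₃ · A₄ · I` (times any `(u)ᵃ`).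

`S` regular local of dimension four with regular system of parameters `x`; nothing here is a statement
of the manuscript under review.

## References

* The Stacks Project, Tags 080A, 080B, 0804, 0BIQ. [StacksProject]
* Q. Liu, *Algebraic Geometry and Arithmetic Curves*, OUP 2002, Thm. 8.1.19 (a). [Liu2002]
* H. Matsumura, *Commutative Ring Theory*, CUP 1986, Thm. 16.2 (i). [Matsumura1987]
-/

-- `Summit.<Summit>.<Sub>.Theorems` with `Sub = Summit` (single-conjunct summit, D-0017)
set_option linter.dupNamespace false

noncomputable section

open CategoryTheory CategoryTheory.Limits AlgebraicGeometry Literature.AlgebraicGeometry.Resolution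
open IsLocalRing

namespace Summit.ResolutionOfSingularities.ResolutionOfSingularities.Theorems

namespace TwoPlanesRung

open ConeRung

universe u

/-- Letters of the word `(a, 1, a)`. [folklore] -/
theorem tp_letters_spec_zero {B : Type*} [One B] (a : B) (r : ℕ) :
    [a, 1, a].getD r 1 = a ∨ [a, 1, a].getD r 1 = 1 := by
  rcases r with _ | _ | _ | r <;> simp

/-- The flag of the word `(a, 1, a)`: `∏_{s<3} (c, L₀⋯L_s) = (c, a)(c, a)(c, a²)`. [folklore] -/
theorem tp_flag_three_zero {B : Type*} [CommRing B] (c a : B) :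
    ∏ s ∈ Finset.range 3, Ideal.span {c, ∏ r ∈ Finset.range (s + 1), [a, 1, a].getD r 1} =
      Ideal.span {c, a} * Ideal.span {c, a} * Ideal.span {c, a ^ 2} := by
  simp only [Finset.prod_range_succ, Finset.prod_range_zero, one_mul, mul_one, List.getD_cons_zero,
    List.getD_cons_succ, pow_two]

section ChartZero

variable {S : Type u} [CommRing S] [IsRegularLocalRing S] (x : Fin 4 → S)
  (hx : Ideal.span (Set.range x) = IsLocalRing.maximalIdeal S)
  (hd : (IsLocalRing.maximalIdeal S).spanFinrank = 4)

local notation3 (prettyPrint := false) "M" => Ideal.span (Set.range x)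
local notation3 (prettyPrint := false) "fT" => x 0 * x 1 + x 2 ^ 3
local notation3 (prettyPrint := false) "B₀" => chartRing x 0
local notation3 (prettyPrint := false) "φ" => chartBase x 0
local notation3 (prettyPrint := false) "u₀" => chartBase x 0 (x 0)
local notation3 (prettyPrint := false) "e[" j "]" => chartGen x 0 j
/-- the strict transform `H♯ = e₀e₁ + u₀ e₂³` of `f` on the `x₀`-chart (`e₀ = 1`) -/
local notation3 (prettyPrint := false) "Hs" => chartGen x 0 0 * chartGen x 0 1 + chartBase x 0 (x 0) * chartGen x 0 2 ^ 3
local notation3 (prettyPrint := false) "U" => Ideal.span {chartBase x 0 (x 0)}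

/-! ### `e₀ = 1` bookkeeping (without rewriting numerals in the chart ring) -/

omit [IsRegularLocalRing S] in
/-- `e₀ · w = w` on the `x₀`-chart. [cite: StacksProject, Tag 0804] -/
theorem e0_mul (w : B₀) : e[0] * w = w := by
  have h1 : e[0] = 1 := chartGen_self x 0
  rw [h1]
  exact one_mul w

omit [IsRegularLocalRing S] in
/-- `e₀` is a unit on the `x₀`-chart. [cite: StacksProject, Tag 0804] -/
theorem isUnit_e0 : IsUnit e[0] := by
  have h1 : e[0] = 1 := chartGen_self x 0
  rw [h1]
  exact isUnit_one

omit [IsRegularLocalRing S] in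
/-- `(H♯, u₀) = (u₀, e₁)`. [folklore] -/
theorem span_Hs_u : Ideal.span {Hs, u₀} = Ideal.span {u₀, e[1]} := by
  rw [e0_mul]
  exact span_pair_add_mul_right u₀ e[1] (e[2] ^ 3)

omit [IsRegularLocalRing S] in
/-- `(e₀e₁, u₀) = (H♯, u₀)`. [folklore] -/
theorem span_e0e1_u : Ideal.span {e[0] * e[1], u₀} = Ideal.span {Hs, u₀} := by
  rw [span_Hs_u, e0_mul, Ideal.span_pair_comm]

omit [IsRegularLocalRing S] in
/-- `(H♯) + (u₀)² = (H♯, u₀²)`. [folklore] -/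
theorem span_Hs_sup_U_sq : Ideal.span {Hs} ⊔ U ^ 2 = Ideal.span {Hs, u₀ ^ 2} := by
  rw [Ideal.span_singleton_pow, Ideal.span_insert]

omit [IsRegularLocalRing S] in
/-- `(H♯) + (u₀)(e₀) + (u₀)² = (H♯, u₀)`. [folklore] -/
theorem span_Hs_sup_U_e0 : Ideal.span {Hs} ⊔ U * Ideal.span {e[0]} ⊔ U ^ 2 = Ideal.span {Hs, u₀} := by
  rw [Ideal.span_singleton_eq_top.mpr (isUnit_e0 x), Ideal.mul_top,
    sup_eq_left.mpr ((Ideal.pow_le_self two_ne_zero).trans le_sup_right), Ideal.span_insert]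

/-! ### The chart images, flag form -/

omit [IsRegularLocalRing S] in
/-- `A₃ = (f) + 𝔪³ ↦ (u₀)² (H♯, u₀)` on `B₀`. [cite: StacksProject, Tag 080B] -/
theorem map_tpA3_zero : (Ideal.span {fT} ⊔ M ^ 3).map φ = U ^ 2 * Ideal.span {Hs, u₀} := by
  rw [map_chartBase_tpA3, span_e0e1_u]

omit [IsRegularLocalRing S] in
/-- `A₄ = (f) + x₀𝔪² + 𝔪⁴ ↦ (u₀)² (H♯, u₀)` on `B₀`. [cite: StacksProject, Tag 080B] -/
theorem map_tpA4_zero :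
    (Ideal.span {fT} ⊔ Ideal.span {x 0} * M ^ 2 ⊔ M ^ 4).map φ = U ^ 2 * Ideal.span {Hs, u₀} := by
  rw [map_chartBase_tpA4, span_Hs_sup_U_e0]

omit [IsRegularLocalRing S] in
/-- `I = (f) + 𝔪⁴ ↦ (u₀)² (H♯, u₀²)` on `B₀`. [cite: StacksProject, Tag 080B] -/
theorem map_tpI_zero : (Ideal.span {fT} ⊔ M ^ 4).map φ = U ^ 2 * Ideal.span {Hs, u₀ ^ 2} := by
  rw [map_chartBase_tpI, span_Hs_sup_U_sq]

omit [IsRegularLocalRing S] in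
/-- `A = (f) + x₀𝔪 + 𝔪³ ↦ (u₀)²` on `B₀` (the plane centre is empty on this chart).
[cite: StacksProject, Tag 080B] -/
theorem map_tpA_zero : (Ideal.span {fT} ⊔ Ideal.span {x 0} * M ⊔ M ^ 3).map φ = U ^ 2 := by
  rw [map_chartBase_tpA, Ideal.span_insert, Ideal.span_singleton_eq_top.mpr (isUnit_e0 x), top_sup_eq,
    Ideal.mul_top]

omit [IsRegularLocalRing S] in
/-- **`A₃ · A₄ · I ↦ (u₀)⁶ · (H♯, u₀)(H♯, u₀)(H♯, u₀²)`**, the flag of the word `(u₀, 1, u₀)`.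
[cite: StacksProject, Tag 080B] -/
theorem map_tpProd_zero :
    ((Ideal.span {fT} ⊔ M ^ 3) * (Ideal.span {fT} ⊔ Ideal.span {x 0} * M ^ 2 ⊔ M ^ 4) *
        (Ideal.span {fT} ⊔ M ^ 4)).map φ =
      (U ^ 2) ^ 3 * ∏ s ∈ Finset.range 3,
        Ideal.span {Hs, ∏ r ∈ Finset.range (s + 1), [u₀, 1, u₀].getD r 1} := by
  rw [Ideal.map_mul, Ideal.map_mul, map_tpA3_zero, map_tpA4_zero, map_tpI_zero, tp_flag_product]
  exact congrArg ((U ^ 2) ^ 3 * ·) (tp_flag_three_zero Hs u₀).symm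

/-! ### `H''`-lite on `B₀` -/

include hx hd in
/-- `H♯ ∉ (u₀)` (`H♯ ≡ e₁ (mod u₀)` and `e₁ ∉ (u₀)`). [cite: StacksProject, Tag 0BIQ] -/
theorem Hs_notMem_span_u : Hs ∉ U := by
  intro h
  apply chartGen_notMem_span_u x hx hd 0 1 one_ne_zero
  have e : e[1] = Hs - u₀ * e[2] ^ 3 := by rw [e0_mul]; ring
  rw [e]
  exact Ideal.sub_mem _ h (Ideal.mul_mem_right _ _ (Ideal.mem_span_singleton_self _))

include hx hd in
/-- **`(H♯, u₀)` is a quasi-regular pair on `B₀`**: `(u₀, H♯)` is weakly regular (`u₀` a non-zero-divisor,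
`B₀/(u₀)` a domain, `H♯ ∉ (u₀)`), swap. [cite: Matsumura1987, Thm. 16.2 (i)] -/
theorem isQuasiRegular_Hs_u :
    IsQuasiRegular (Fin.cons Hs (fun _ : Fin 1 => u₀) : Fin 2 → B₀) := by
  haveI : IsDomain S := isDomain_of_isRegularLocalRing S
  haveI := isDomain_residue x hx
  have hqr := isQuasiRegular_regularSystemOfParameters hd x hx
  haveI := isDomain_chartRing_quot_span x 0 hqr
  have hx0 : x 0 ≠ 0 := (isRsopPart_comp_of_rsop hd x hx id Function.injective_id).ne_zero 0
  haveI : IsDomain B₀ := isDomain_chartRing x 0 hx0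
  haveI : NoZeroDivisors B₀ := IsDomain.to_noZeroDivisors (chartRing x 0)
  have hu : u₀ ∈ nonZeroDivisors B₀ :=
    reesChartBase_mem_nonZeroDivisors (x 0) (Ideal.mem_span_range_self (f := x) (x := 0))
  have hH := Hs_notMem_span_u x hx hd
  have hH0 : Hs ∈ nonZeroDivisors B₀ :=
    mem_nonZeroDivisors_of_ne_zero (fun h0 => hH (by rw [h0]; exact zero_mem _))
  exact isQuasiRegular_pair_swap _ _ hu hH0 (CoreRungTower.isWeaklyRegular_pair_of_notMem hu hH)

include hx hd in
/-- **`B₀ ⧸ (H♯, u₀) = B₀ ⧸ (u₀, e₁)` is a regular ring** (a polynomial ring over the residue field).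
[cite: StacksProject, Tag 0BIQ] -/
theorem isRegularRing_quot_span_Hs_u : IsRegularRing (B₀ ⧸ Ideal.span {Hs, u₀}) := by
  haveI := isRegularRing_residue x hx
  have hqr := isQuasiRegular_regularSystemOfParameters hd x hx
  haveI h := CoreRungTower.isRegularRing_quot_chartFamily x 0
    (fun _ : Fin 1 => (⟨1, one_ne_zero⟩ : {j : Fin 4 // j ≠ 0})) hqr
  have hEq : Ideal.span (Set.range (Fin.cons u₀ fun _ : Fin 1 =>
      chartGen x 0 (⟨1, one_ne_zero⟩ : {j : Fin 4 // j ≠ 0}).1)) = Ideal.span {Hs, u₀} := by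
    rw [Fin.range_cons, Set.range_const, span_Hs_u]
  exact IsRegularRing.of_ringEquiv (R := B₀ ⧸ Ideal.span (Set.range (Fin.cons u₀ fun _ : Fin 1 =>
      chartGen x 0 (⟨1, one_ne_zero⟩ : {j : Fin 4 // j ≠ 0}).1))) (Ideal.quotEquivOfEq hEq)

include hx hd in
/-- **Every blowing up of `Spec B₀` along `(u₀)ᵃ · ∏_{s<N} (H♯, L₀⋯L_s)` with letters in `{u₀, 1}` is
regular** (twist, then `isRegular_of_isBlowup_letterTower_two''`).
[cite: StacksProject, Tag 080A] [cite: StacksProject, Tag 080B] [cite: Liu2002, Thm. 8.1.19 (a)] -/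
theorem isRegular_of_isBlowup_zFlag (a N : ℕ) (L : ℕ → B₀) (hL : ∀ r, L r = u₀ ∨ L r = 1)
    {Y : Scheme.{u}} {ρ : Y ⟶ Spec (.of B₀)}
    (hρ : IsBlowup ρ (affineBlowup.idealSheaf (U ^ a * ∏ s ∈ Finset.range N,
      Ideal.span {Hs, ∏ r ∈ Finset.range (s + 1), L r}))) :
    Scheme.IsRegular Y := by
  haveI : IsDomain S := isDomain_of_isRegularLocalRing S
  haveI : IsRegularRing B₀ := isRegularRing_chart x hx hd 0
  have hx0 : x 0 ≠ 0 := (isRsopPart_comp_of_rsop hd x hx id Function.injective_id).ne_zero 0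
  haveI : IsDomain B₀ := isDomain_chartRing x 0 hx0
  have hu : u₀ ∈ nonZeroDivisors B₀ :=
    reesChartBase_mem_nonZeroDivisors (x 0) (Ideal.mem_span_range_self (f := x) (x := 0))
  rw [Ideal.span_singleton_pow] at hρ
  exact CoreRungTower.isRegular_of_isBlowup_span_singleton_mul (pow_mem hu a) _
    (fun Y' ρ' h' => isRegular_of_isBlowup_letterTower_two'' N Hs u₀ L hL
      (isQuasiRegular_Hs_u x hx hd) (isRegularRing_quot_span_Hs_u x hx hd)
      (nonZeroDivisors.ne_zero hu) h') hρ

include hx hd in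
/-- **The `x₀`-chart of the rank-two member is resolved by the companion factors**: every blowing
up of `Spec B₀` along the image of `A₃ · A₄ · I`, times any power of `(u₀)`, is regular.
[cite: StacksProject, Tag 080A] [cite: StacksProject, Tag 080B] [cite: Liu2002, Thm. 8.1.19 (a)] -/
theorem isRegular_of_isBlowup_tpProd_zero (a : ℕ) {Y : Scheme.{u}} {ρ : Y ⟶ Spec (.of B₀)}
    (hρ : IsBlowup ρ (affineBlowup.idealSheaf (U ^ a *
      ((Ideal.span {fT} ⊔ M ^ 3) * (Ideal.span {fT} ⊔ Ideal.span {x 0} * M ^ 2 ⊔ M ^ 4) *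
        (Ideal.span {fT} ⊔ M ^ 4)).map φ))) :
    Scheme.IsRegular Y := by
  rw [map_tpProd_zero, ← mul_assoc, ← pow_mul, ← pow_add] at hρ
  exact isRegular_of_isBlowup_zFlag x hx hd (a + 2 * 3) 3 (fun r => [u₀, 1, u₀].getD r 1)
    (tp_letters_spec_zero u₀) hρ

end ChartZero

end TwoPlanesRung

end Summit.ResolutionOfSingularities.ResolutionOfSingularities.Theorems

end
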